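import Mathlib
import HarnessLib
import Summits.Ventures.LatticeQCDFlow.Scaling.AutoregressiveGaugeHeatBathRanked

/-!
# LatticeQCDFlow / Scaling — the TWO-PLAQUETTE CONSTANT `M₂`: `∫ w(h) w(a h^{±1} b) dHaar ≤ c·M₂` with
# `M₂ < M` as soon as the top level set of `w` is Haar-small

HONEST FRAMING: exact (Metropolis-corrected) sampling algorithms for lattice gauge theory;
figures of merit are autocorrelation/cost numbers at stated couplings and volumes; no
continuum-physics claim.

Venture `LatticeQCDFlow` (cell pub-lqcd), topic `Scaling`, FANOUT row 30 (lean-1, GEN-26) — OUR WORK on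
THEORY-2.md §4 row C5.  The floor of the exact one-plaquette heat-bath sampler
(`Scaling/AutoregressiveGaugeHeatBathVolumeFloor`, `…VolumeLaw`) is of order `(M/M₂)^s` with `M₂` any
constant such that `∫ w(h) w(a h b) dHaar(h) ≤ c·M₂` and `∫ w(h) w(a h⁻¹ b) dHaar(h) ≤ c·M₂` for all
`a, b ∈ G` (`c = ∫ w dHaar`, `M = sup w`).  This file supplies such constants:

* §1 **`twoWeight_le_max`**, **`twoWeight_inv_le_max`** — `M₂ = M` always works (the floor is then
  trivial, as it must be for a constant weight);
* §2 **`twoWeight_le_of_level`**, **`twoWeight_inv_le_of_level`** — if `w ≤ M'` off a measurable set `O`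
  then `∫ w(h) w(a h^{±1} b) dHaar ≤ c·M' + (M − M')·M·Haar(O)` (translation and inversion invariance of
  Haar: the shifted level set has the same mass);
* §3 **`exists_twoWeightConstant_lt`** — hence if `M' < M` and `M·Haar(O) < c` there is an `M₂ < M`
  with both bounds: the weight cannot sit near its maximum on two plaquettes sharing a freshly drawn
  link as often as on one;
* §4 **`exists_twoWeightConstant_lt_of_null`** — in particular whenever `w` is continuous with
  `0 < w ≤ M` and its top level set `{w = M}` is Haar-null (every Wilson-type weight `e^{β Re tr ρ(U)}` on
  a connected compact Lie group of positive dimension, maximal exactly at `U = 1`), an `M₂ < M` exists —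
  so the volume law's floor `(M/M₂)^{k_min/(2d−3)}` is GENUINELY EXPONENTIAL IN THE VOLUME.

* §5 **`twoWeight_le_sq`**, **`twoWeight_inv_le_sq`**, **`exists_twoWeightConstant_lt_of_lt`** — by
  `2xy ≤ x² + y²` and invariance, `∫ w(h) w(a h^{±1} b) dHaar ≤ ∫ w²`: the heat-bath mean `M₂ = ∫w²/∫w` is
  always a two-plaquette constant (the best one), and `M₂ < M` for EVERY continuous `0 < w ≤ M` that is
  not identically `M` — no hypothesis on the top level set.

No `def`, no `sorry`, nothing cited as a fact.  (For `U(1)` Wilson weights `M₂/M = I₀(2β)/(I₀(β)e^{β}) →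
2^{−1/2}` as `β → ∞` — a remark, not a theorem here.)
-/

noncomputable section

namespace Summit.Ventures.LatticeQCDFlow.Theory2.Autoregressive

open MeasureTheory Filter Set
open Literature.MathematicalPhysics.QuantumFieldTheory Literature.MathematicalPhysics.QuantumLattice
open scoped ENNReal Topology

variable {G : Type*} [Group G] [TopologicalSpace G] [IsTopologicalGroup G] [CompactSpace G]
  [MeasurableSpace G] [BorelSpace G]

/-! ## §1 The trivial constant `M₂ = M` -/

/-- `∫ w(h) w(a h b) dHaar ≤ c·M` for `0 ≤ w ≤ M` integrable. [ours] -/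
theorem twoWeight_le_max {w : G → ℝ} (hwi : Integrable w (haarProbability G)) (hw0 : ∀ g, 0 ≤ w g)
    {M : ℝ} (hM : ∀ g, w g ≤ M) (a b : G) :
    ∫ h, w h * w (a * h * b) ∂(haarProbability G) ≤ (∫ g, w g ∂(haarProbability G)) * M := by
  rw [← integral_mul_const]
  refine integral_mono_of_nonneg (ae_of_all _ fun h => mul_nonneg (hw0 _) (hw0 _)) (hwi.mul_const M)
    (ae_of_all _ fun h => mul_le_mul_of_nonneg_left (hM _) (hw0 _))

/-- `∫ w(h) w(a h⁻¹ b) dHaar ≤ c·M` for `0 ≤ w ≤ M` integrable. [ours] -/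
theorem twoWeight_inv_le_max {w : G → ℝ} (hwi : Integrable w (haarProbability G)) (hw0 : ∀ g, 0 ≤ w g)
    {M : ℝ} (hM : ∀ g, w g ≤ M) (a b : G) :
    ∫ h, w h * w (a * h⁻¹ * b) ∂(haarProbability G) ≤ (∫ g, w g ∂(haarProbability G)) * M := by
  rw [← integral_mul_const]
  refine integral_mono_of_nonneg (ae_of_all _ fun h => mul_nonneg (hw0 _) (hw0 _)) (hwi.mul_const M)
    (ae_of_all _ fun h => mul_le_mul_of_nonneg_left (hM _) (hw0 _))

/-! ## §2 The level-set bound -/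

/-- **Level-set bound.**  `0 ≤ w ≤ M` integrable, `w ≤ M'` off the measurable set `O`, `M' ≤ M`.  Then
for all `a, b`: `∫ w(h) w(a h b) dHaar(h) ≤ c·M' + (M − M')·M·Haar(O)` — split `w(a h b) ≤ M' + (M − M')·𝟙_O(a h b)`
and use `∫ 𝟙_O(a h b) dHaar(h) = Haar(O)`. [ours] -/
theorem twoWeight_le_of_level {w : G → ℝ} (hwi : Integrable w (haarProbability G))
    (hw0 : ∀ g, 0 ≤ w g) {M : ℝ} (hM : ∀ g, w g ≤ M) {O : Set G} (hO : MeasurableSet O) {M' : ℝ}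
    (hM' : ∀ g, g ∉ O → w g ≤ M') (hM'M : M' ≤ M) (a b : G) :
    ∫ h, w h * w (a * h * b) ∂(haarProbability G) ≤
      (∫ g, w g ∂(haarProbability G)) * M' + (M - M') * M * (haarProbability G).real O := by
  have hMnn : 0 ≤ M := (hw0 1).trans (hM 1)
  -- pointwise: `w(h) w(ahb) ≤ w(h) M' + (M − M') M 𝟙_O(ahb)`
  have hpt : ∀ h, w h * w (a * h * b) ≤ w h * M' + (M - M') * M * O.indicator (fun _ => (1 : ℝ)) (a * h * b) := by
    intro h
    by_cases hO' : a * h * b ∈ O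
    · rw [Set.indicator_of_mem hO', mul_one]
      have h1 : w h * w (a * h * b) ≤ w h * M := mul_le_mul_of_nonneg_left (hM _) (hw0 _)
      have h2 : w h * M ≤ w h * M' + (M - M') * M := by nlinarith [hw0 h, hM h, hM'M, hMnn]
      exact h1.trans h2
    · rw [Set.indicator_of_notMem hO', mul_zero, add_zero]
      exact mul_le_mul_of_nonneg_left (hM' _ hO') (hw0 _)
  have hind_meas : Measurable fun h : G => O.indicator (fun _ => (1 : ℝ)) (a * h * b) :=
    (measurable_const.indicator hO).comp ((measurable_const_mul a).mul_const b)
  have hind_int : Integrable (fun h : G => O.indicator (fun _ => (1 : ℝ)) (a * h * b)) (haarProbability G) := by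
    refine Integrable.mono' (integrable_const (1 : ℝ)) hind_meas.aestronglyMeasurable (ae_of_all _ fun h => ?_)
    rw [Real.norm_eq_abs]
    by_cases hO' : a * h * b ∈ O
    · rw [Set.indicator_of_mem hO', abs_one]
    · rw [Set.indicator_of_notMem hO', abs_zero]; exact zero_le_one
  have hshift : ∫ h, O.indicator (fun _ => (1 : ℝ)) (a * h * b) ∂(haarProbability G) =
      (haarProbability G).real O := by
    have h1 := integral_mul_left_eq_self (μ := haarProbability G)
      (fun h => O.indicator (fun _ => (1 : ℝ)) (h * b)) a
    have h2 := integral_mul_right_eq_self (μ := haarProbability G) (O.indicator fun _ => (1 : ℝ)) b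
    rw [h1, h2, integral_indicator_const (1 : ℝ) hO, smul_eq_mul, mul_one]
  calc ∫ h, w h * w (a * h * b) ∂(haarProbability G)
      ≤ ∫ h, (w h * M' + (M - M') * M * O.indicator (fun _ => (1 : ℝ)) (a * h * b)) ∂(haarProbability G) :=
        integral_mono_of_nonneg (ae_of_all _ fun h => mul_nonneg (hw0 _) (hw0 _))
          ((hwi.mul_const M').add (hind_int.const_mul _)) (ae_of_all _ hpt)
    _ = (∫ g, w g ∂(haarProbability G)) * M' + (M - M') * M * (haarProbability G).real O := by
        rw [integral_add (hwi.mul_const M') (hind_int.const_mul _), integral_mul_const, integral_const_mul,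
          hshift]

/-- **Level-set bound, inverted link**: the same for `∫ w(h) w(a h⁻¹ b) dHaar(h)` (inversion invariance).
[ours] -/
theorem twoWeight_inv_le_of_level {w : G → ℝ} (hwi : Integrable w (haarProbability G))
    (hw0 : ∀ g, 0 ≤ w g) {M : ℝ} (hM : ∀ g, w g ≤ M) {O : Set G} (hO : MeasurableSet O) {M' : ℝ}
    (hM' : ∀ g, g ∉ O → w g ≤ M') (hM'M : M' ≤ M) (a b : G) :
    ∫ h, w h * w (a * h⁻¹ * b) ∂(haarProbability G) ≤
      (∫ g, w g ∂(haarProbability G)) * M' + (M - M') * M * (haarProbability G).real O := by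
  have hMnn : 0 ≤ M := (hw0 1).trans (hM 1)
  have hpt : ∀ h, w h * w (a * h⁻¹ * b) ≤
      w h * M' + (M - M') * M * O.indicator (fun _ => (1 : ℝ)) (a * h⁻¹ * b) := by
    intro h
    by_cases hO' : a * h⁻¹ * b ∈ O
    · rw [Set.indicator_of_mem hO', mul_one]
      have h1 : w h * w (a * h⁻¹ * b) ≤ w h * M := mul_le_mul_of_nonneg_left (hM _) (hw0 _)
      have h2 : w h * M ≤ w h * M' + (M - M') * M := by nlinarith [hw0 h, hM h, hM'M, hMnn]
      exact h1.trans h2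
    · rw [Set.indicator_of_notMem hO', mul_zero, add_zero]
      exact mul_le_mul_of_nonneg_left (hM' _ hO') (hw0 _)
  have hind_meas : Measurable fun h : G => O.indicator (fun _ => (1 : ℝ)) (a * h⁻¹ * b) :=
    (measurable_const.indicator hO).comp (((measurable_const_mul a).comp measurable_inv).mul_const b)
  have hind_int : Integrable (fun h : G => O.indicator (fun _ => (1 : ℝ)) (a * h⁻¹ * b))
      (haarProbability G) := by
    refine Integrable.mono' (integrable_const (1 : ℝ)) hind_meas.aestronglyMeasurable (ae_of_all _ fun h => ?_)
    rw [Real.norm_eq_abs]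
    by_cases hO' : a * h⁻¹ * b ∈ O
    · rw [Set.indicator_of_mem hO', abs_one]
    · rw [Set.indicator_of_notMem hO', abs_zero]; exact zero_le_one
  have hshift : ∫ h, O.indicator (fun _ => (1 : ℝ)) (a * h⁻¹ * b) ∂(haarProbability G) =
      (haarProbability G).real O := by
    have h0 := integral_inv_eq_self (fun h => O.indicator (fun _ => (1 : ℝ)) (a * h * b)) (haarProbability G)
    have h1 := integral_mul_left_eq_self (μ := haarProbability G)
      (fun h => O.indicator (fun _ => (1 : ℝ)) (h * b)) a
    have h2 := integral_mul_right_eq_self (μ := haarProbability G) (O.indicator fun _ => (1 : ℝ)) b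
    rw [h0, h1, h2, integral_indicator_const (1 : ℝ) hO, smul_eq_mul, mul_one]
  calc ∫ h, w h * w (a * h⁻¹ * b) ∂(haarProbability G)
      ≤ ∫ h, (w h * M' + (M - M') * M * O.indicator (fun _ => (1 : ℝ)) (a * h⁻¹ * b)) ∂(haarProbability G) :=
        integral_mono_of_nonneg (ae_of_all _ fun h => mul_nonneg (hw0 _) (hw0 _))
          ((hwi.mul_const M').add (hind_int.const_mul _)) (ae_of_all _ hpt)
    _ = (∫ g, w g ∂(haarProbability G)) * M' + (M - M') * M * (haarProbability G).real O := by
        rw [integral_add (hwi.mul_const M') (hind_int.const_mul _), integral_mul_const, integral_const_mul,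
          hshift]

/-! ## §3 A strict constant from a small top level set -/

/-- **`M₂ < M` from a Haar-small top level set.**  `0 ≤ w ≤ M` integrable with `c = ∫ w dHaar > 0`;
`w ≤ M' < M` off a measurable `O` with `M·Haar(O) < c`.  Then `M₂ := M' + (M − M')·M·Haar(O)/c < M` is a
two-plaquette constant of `w` (both the direct and the inverted bound). [ours] -/
theorem exists_twoWeightConstant_lt {w : G → ℝ} (hwi : Integrable w (haarProbability G))
    (hw0 : ∀ g, 0 ≤ w g) (hc : 0 < ∫ g, w g ∂(haarProbability G)) {M : ℝ} (hM : ∀ g, w g ≤ M)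
    {O : Set G} (hO : MeasurableSet O) {M' : ℝ} (hM' : ∀ g, g ∉ O → w g ≤ M')
    (hM'M : M' < M) (hsmall : M * (haarProbability G).real O < ∫ g, w g ∂(haarProbability G)) :
    ∃ M₂ : ℝ, M₂ < M ∧
      (∀ a b : G, ∫ h, w h * w (a * h * b) ∂(haarProbability G) ≤ (∫ g, w g ∂(haarProbability G)) * M₂) ∧
      (∀ a b : G, ∫ h, w h * w (a * h⁻¹ * b) ∂(haarProbability G) ≤ (∫ g, w g ∂(haarProbability G)) * M₂) := by
  set c : ℝ := ∫ g, w g ∂(haarProbability G) with hcdef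
  refine ⟨M' + (M - M') * M * (haarProbability G).real O / c, ?_, fun a b => ?_, fun a b => ?_⟩
  · have h1 : (M - M') * M * (haarProbability G).real O / c < M - M' := by
      rw [div_lt_iff₀ hc]
      have : (M - M') * (M * (haarProbability G).real O) < (M - M') * c :=
        mul_lt_mul_of_pos_left hsmall (by linarith)
      linarith [this]
    linarith
  · have h := twoWeight_le_of_level hwi hw0 hM hO hM' hM'M.le a b
    have e : c * (M' + (M - M') * M * (haarProbability G).real O / c) =
        c * M' + (M - M') * M * (haarProbability G).real O := by
      field_simp
    rw [e]; exact h
  · have h := twoWeight_inv_le_of_level hwi hw0 hM hO hM' hM'M.le a b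
    have e : c * (M' + (M - M') * M * (haarProbability G).real O / c) =
        c * M' + (M - M') * M * (haarProbability G).real O := by
      field_simp
    rw [e]; exact h

/-! ## §4 A Haar-null top level set suffices -/

/-- **`M₂ < M` whenever the top level set is Haar-null.**  `w` continuous with `0 < w ≤ M` on the compact
group `G` and `Haar{w = M} = 0`.  Then some `M₂ < M` satisfies `∫ w(h) w(a h^{±1} b) dHaar ≤ c·M₂` for all
`a, b` — the levels `{w > M − 1/(n+1)}` shrink to the null top set, so one of them has `M·Haar < c`.
[ours] -/
theorem exists_twoWeightConstant_lt_of_null {w : G → ℝ} (hw : Continuous w) (hw0 : ∀ g, 0 < w g)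
    {M : ℝ} (hM : ∀ g, w g ≤ M) (hnull : haarProbability G {g | w g = M} = 0) :
    ∃ M₂ : ℝ, M₂ < M ∧
      (∀ a b : G, ∫ h, w h * w (a * h * b) ∂(haarProbability G) ≤ (∫ g, w g ∂(haarProbability G)) * M₂) ∧
      (∀ a b : G, ∫ h, w h * w (a * h⁻¹ * b) ∂(haarProbability G) ≤ (∫ g, w g ∂(haarProbability G)) * M₂) := by
  have hwm : Measurable w := hw.measurable
  have hwi : Integrable w (haarProbability G) :=
    Literature.Probability.LatticeModels.integrable_of_continuous_compactSpace _ hw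
  have hc : 0 < ∫ g, w g ∂(haarProbability G) := haarProbability_integral_pos_of_continuous_pos hw hw0
  have hMpos : 0 < M := (hw0 1).trans_le (hM 1)
  -- the levels `O n = {w > M − 1/(n+1)}` decrease to the top set
  set O : ℕ → Set G := fun n => {g | M - 1 / ((n : ℝ) + 1) < w g} with hOdef
  have hOmeas : ∀ n, MeasurableSet (O n) := fun n => measurableSet_lt measurable_const hwm
  have hOanti : Antitone O := by
    intro i j hij g hg
    simp only [hOdef, Set.mem_setOf_eq] at hg ⊢
    have : (1 : ℝ) / ((j : ℝ) + 1) ≤ 1 / ((i : ℝ) + 1) :=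
      one_div_le_one_div_of_le (by positivity) (by exact_mod_cast Nat.succ_le_succ hij)
    linarith
  have hOinter : ⋂ n, O n = {g | w g = M} := by
    ext g
    simp only [Set.mem_iInter, hOdef, Set.mem_setOf_eq]
    constructor
    · intro h
      refine le_antisymm (hM g) ?_
      by_contra hlt
      push Not at hlt
      obtain ⟨n, hn⟩ := exists_nat_one_div_lt (sub_pos.2 hlt)
      have := h n
      linarith
    · intro h n
      rw [h]
      have : (0 : ℝ) < 1 / ((n : ℝ) + 1) := by positivity
      linarith
  have htend : Tendsto (fun n => haarProbability G (O n)) atTop (𝓝 (haarProbability G (⋂ n, O n))) :=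
    tendsto_measure_iInter_atTop (fun n => (hOmeas n).nullMeasurableSet) hOanti
      ⟨0, measure_ne_top _ _⟩
  rw [hOinter, hnull] at htend
  -- pick a level with `M · Haar(O n) < c`
  have hεpos : (0 : ℝ≥0∞) < ENNReal.ofReal (((∫ g, w g ∂(haarProbability G)) / 2) / M) :=
    ENNReal.ofReal_pos.2 (div_pos (half_pos hc) hMpos)
  obtain ⟨n, hn⟩ := (htend.eventually (gt_mem_nhds hεpos)).exists
  have hreal : (haarProbability G).real (O n) < ((∫ g, w g ∂(haarProbability G)) / 2) / M := by
    rw [measureReal_def]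
    have := (ENNReal.toReal_lt_toReal (measure_ne_top _ _) ENNReal.ofReal_ne_top).2 hn
    rwa [ENNReal.toReal_ofReal (div_nonneg (half_pos hc).le hMpos.le)] at this
  have hsmall : M * (haarProbability G).real (O n) < ∫ g, w g ∂(haarProbability G) := by
    have h1 : M * (haarProbability G).real (O n) < M * (((∫ g, w g ∂(haarProbability G)) / 2) / M) :=
      mul_lt_mul_of_pos_left hreal hMpos
    have h2 : M * (((∫ g, w g ∂(haarProbability G)) / 2) / M) = (∫ g, w g ∂(haarProbability G)) / 2 := by
      field_simp
    linarith [h1, h2]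
  -- off `O n` the weight is `≤ M − 1/(n+1)`
  have hM'M : M - 1 / ((n : ℝ) + 1) < M := by
    have : (0 : ℝ) < 1 / ((n : ℝ) + 1) := by positivity
    linarith
  by_cases hM'0 : 0 ≤ M - 1 / ((n : ℝ) + 1)
  · exact exists_twoWeightConstant_lt hwi (fun g => (hw0 g).le) hc hM (hOmeas n)
      (fun g hg => by simpa [hOdef] using hg) hM'M hsmall
  · -- degenerate level (`M < 1/(n+1)`): use `M' = 0` off `O n`… every `g` lies in `O n`
    push Not at hM'0
    refine exists_twoWeightConstant_lt hwi (fun g => (hw0 g).le) hc hM (hOmeas n)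
      (fun g hg => ?_) hMpos hsmall
    exfalso
    apply hg
    simp only [hOdef, Set.mem_setOf_eq]
    linarith [hw0 g]

/-! ## §5 The Cauchy–Schwarz constant `M₂ = ∫w² / ∫w` — no hypothesis on the top level set -/

/-- **`∫ w(h) w(a h b) dHaar ≤ ∫ w² dHaar`** for continuous `w` (`2xy ≤ x² + y²` pointwise, then translation
invariance of Haar): the MEAN OF `w` UNDER THE ONE-PLAQUETTE HEAT BATH, `∫w²/∫w`, is always a two-plaquette
constant — and it is the best one (equality at `a = b = 1`). [ours] -/
theorem twoWeight_le_sq {w : G → ℝ} (hw : Continuous w) (a b : G) :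
    ∫ h, w h * w (a * h * b) ∂(haarProbability G) ≤ ∫ h, w h ^ 2 ∂(haarProbability G) := by
  have hwi2 : Integrable (fun h => w h ^ 2) (haarProbability G) :=
    Literature.Probability.LatticeModels.integrable_of_continuous_compactSpace _ (hw.pow 2)
  have hshift_c : Continuous fun h => w (a * h * b) :=
    hw.comp ((continuous_const.mul continuous_id).mul continuous_const)
  have hwi2' : Integrable (fun h => w (a * h * b) ^ 2) (haarProbability G) :=
    Literature.Probability.LatticeModels.integrable_of_continuous_compactSpace _ (hshift_c.pow 2)
  have hprod : Integrable (fun h => w h * w (a * h * b)) (haarProbability G) :=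
    Literature.Probability.LatticeModels.integrable_of_continuous_compactSpace _ (hw.mul hshift_c)
  have hB : Integrable (fun h => (w h ^ 2 + w (a * h * b) ^ 2) / 2) (haarProbability G) :=
    (hwi2.add hwi2').div_const 2
  have hshift : ∫ h, w (a * h * b) ^ 2 ∂(haarProbability G) = ∫ h, w h ^ 2 ∂(haarProbability G) := by
    have h1 := integral_mul_left_eq_self (μ := haarProbability G) (fun h => w (h * b) ^ 2) a
    have h2 := integral_mul_right_eq_self (μ := haarProbability G) (fun h => w h ^ 2) b
    rw [h1, h2]
  have hpt : ∀ h, w h * w (a * h * b) ≤ (w h ^ 2 + w (a * h * b) ^ 2) / 2 := fun h => by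
    nlinarith [sq_nonneg (w h - w (a * h * b))]
  have hle : ∫ h, w h * w (a * h * b) ∂(haarProbability G) ≤
      ∫ h, (w h ^ 2 + w (a * h * b) ^ 2) / 2 ∂(haarProbability G) := integral_mono hprod hB hpt
  have heq : ∫ h, (w h ^ 2 + w (a * h * b) ^ 2) / 2 ∂(haarProbability G) =
      ∫ h, w h ^ 2 ∂(haarProbability G) := by
    rw [integral_div, integral_add hwi2 hwi2', hshift]; ring
  exact hle.trans_eq heq

/-- **`∫ w(h) w(a h⁻¹ b) dHaar ≤ ∫ w² dHaar`** — the inverted link (inversion invariance, then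
`twoWeight_le_sq`). [ours] -/
theorem twoWeight_inv_le_sq {w : G → ℝ} (hw : Continuous w) (a b : G) :
    ∫ h, w h * w (a * h⁻¹ * b) ∂(haarProbability G) ≤ ∫ h, w h ^ 2 ∂(haarProbability G) := by
  -- substitute `h ↦ h⁻¹`: `∫ w(h) w(a h⁻¹ b) = ∫ w(h⁻¹) w(a h b)`
  have h0 := integral_inv_eq_self (fun h => w h⁻¹ * w (a * h * b)) (haarProbability G)
  simp only [inv_inv] at h0
  rw [h0]
  have hwinv : Continuous fun h : G => w h⁻¹ := hw.comp continuous_inv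
  have hwi2 : Integrable (fun h => w h ^ 2) (haarProbability G) :=
    Literature.Probability.LatticeModels.integrable_of_continuous_compactSpace _ (hw.pow 2)
  have hwi2i : Integrable (fun h => w h⁻¹ ^ 2) (haarProbability G) :=
    Literature.Probability.LatticeModels.integrable_of_continuous_compactSpace _ (hwinv.pow 2)
  have hshift_c : Continuous fun h => w (a * h * b) :=
    hw.comp ((continuous_const.mul continuous_id).mul continuous_const)
  have hwi2' : Integrable (fun h => w (a * h * b) ^ 2) (haarProbability G) :=
    Literature.Probability.LatticeModels.integrable_of_continuous_compactSpace _ (hshift_c.pow 2)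
  have hprod : Integrable (fun h => w h⁻¹ * w (a * h * b)) (haarProbability G) :=
    Literature.Probability.LatticeModels.integrable_of_continuous_compactSpace _ (hwinv.mul hshift_c)
  have hB : Integrable (fun h => (w h⁻¹ ^ 2 + w (a * h * b) ^ 2) / 2) (haarProbability G) :=
    (hwi2i.add hwi2').div_const 2
  have hinv2 : ∫ h, w h⁻¹ ^ 2 ∂(haarProbability G) = ∫ h, w h ^ 2 ∂(haarProbability G) :=
    integral_inv_eq_self (fun h => w h ^ 2) (haarProbability G)
  have hshift : ∫ h, w (a * h * b) ^ 2 ∂(haarProbability G) = ∫ h, w h ^ 2 ∂(haarProbability G) := by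
    have h1' := integral_mul_left_eq_self (μ := haarProbability G) (fun h => w (h * b) ^ 2) a
    have h2' := integral_mul_right_eq_self (μ := haarProbability G) (fun h => w h ^ 2) b
    rw [h1', h2']
  have hpt : ∀ h, w h⁻¹ * w (a * h * b) ≤ (w h⁻¹ ^ 2 + w (a * h * b) ^ 2) / 2 := fun h => by
    nlinarith [sq_nonneg (w h⁻¹ - w (a * h * b))]
  have hle : ∫ h, w h⁻¹ * w (a * h * b) ∂(haarProbability G) ≤
      ∫ h, (w h⁻¹ ^ 2 + w (a * h * b) ^ 2) / 2 ∂(haarProbability G) := integral_mono hprod hB hpt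
  have heq : ∫ h, (w h⁻¹ ^ 2 + w (a * h * b) ^ 2) / 2 ∂(haarProbability G) =
      ∫ h, w h ^ 2 ∂(haarProbability G) := by
    rw [integral_div, integral_add hwi2i hwi2', hinv2, hshift]; ring
  exact hle.trans_eq heq

/-- **`∫w²/∫w < M` FOR EVERY NON-CONSTANT CONTINUOUS WEIGHT**: `w` continuous, `0 < w ≤ M`, `w(g₀) < M`
for some `g₀` (`∫ w(M − w) dHaar > 0`: Haar charges the open set where `w < M`). [ours] -/
theorem integral_sq_div_integral_lt {w : G → ℝ} (hw : Continuous w) (hw0 : ∀ g, 0 < w g) {M : ℝ}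
    (hM : ∀ g, w g ≤ M) {g₀ : G} (hg₀ : w g₀ < M) :
    (∫ h, w h ^ 2 ∂(haarProbability G)) / (∫ g, w g ∂(haarProbability G)) < M := by
  have hc : 0 < ∫ g, w g ∂(haarProbability G) := haarProbability_integral_pos_of_continuous_pos hw hw0
  rw [div_lt_iff₀ hc]
  have hf : Continuous fun g => w g * (M - w g) := hw.mul (continuous_const.sub hw)
  have hpos : 0 < ∫ g, w g * (M - w g) ∂(haarProbability G) :=
    hf.integral_pos_of_hasCompactSupport_nonneg_nonzero (HasCompactSupport.of_compactSpace _)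
      (fun g => mul_nonneg (hw0 g).le (sub_nonneg.2 (hM g)))
      (x := g₀) (mul_pos (hw0 g₀) (sub_pos.2 hg₀)).ne'
  have hwi : Integrable w (haarProbability G) :=
    Literature.Probability.LatticeModels.integrable_of_continuous_compactSpace _ hw
  have hwi2 : Integrable (fun h => w h ^ 2) (haarProbability G) :=
    Literature.Probability.LatticeModels.integrable_of_continuous_compactSpace _ (hw.pow 2)
  have e : ∫ g, w g * (M - w g) ∂(haarProbability G) =
      M * ∫ g, w g ∂(haarProbability G) - ∫ h, w h ^ 2 ∂(haarProbability G) := by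
    have e1 : ∀ g, w g * (M - w g) = M * w g - w g ^ 2 := fun g => by ring
    simp_rw [e1]
    rw [integral_sub (hwi.const_mul M) hwi2, integral_const_mul]
  rw [e] at hpos
  linarith

/-- **THE HEAT-BATH MEAN `M₂ = ∫w²/∫w` IS A TWO-PLAQUETTE CONSTANT `< M`** for every continuous
`0 < w ≤ M` not identically `M` — no hypothesis on the top level set: the volume law's floor `(M/M₂)^s` is
genuinely exponential for every non-constant weight, with the explicit base
`M/M₂ = M·∫w dHaar / ∫w² dHaar`. [ours] -/
theorem exists_twoWeightConstant_lt_of_lt {w : G → ℝ} (hw : Continuous w) (hw0 : ∀ g, 0 < w g)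
    {M : ℝ} (hM : ∀ g, w g ≤ M) {g₀ : G} (hg₀ : w g₀ < M) :
    ∃ M₂ : ℝ, M₂ = (∫ h, w h ^ 2 ∂(haarProbability G)) / (∫ g, w g ∂(haarProbability G)) ∧ M₂ < M ∧
      (∀ a b : G, ∫ h, w h * w (a * h * b) ∂(haarProbability G) ≤ (∫ g, w g ∂(haarProbability G)) * M₂) ∧
      (∀ a b : G, ∫ h, w h * w (a * h⁻¹ * b) ∂(haarProbability G) ≤ (∫ g, w g ∂(haarProbability G)) * M₂) := by
  have hc : 0 < ∫ g, w g ∂(haarProbability G) := haarProbability_integral_pos_of_continuous_pos hw hw0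
  refine ⟨_, rfl, integral_sq_div_integral_lt hw hw0 hM hg₀, fun a b => ?_, fun a b => ?_⟩
  · rw [mul_div_cancel₀ _ hc.ne']; exact twoWeight_le_sq hw a b
  · rw [mul_div_cancel₀ _ hc.ne']; exact twoWeight_inv_le_sq hw a b

end Summit.Ventures.LatticeQCDFlow.Theory2.Autoregressive

end
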